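import Summits.BirchSwinnertonDyer.BirchSwinnertonDyer.Theorems.ByReductionTypeAtTwoAdditivePotGoodKatoHalf
import Summits.BirchSwinnertonDyer.BirchSwinnertonDyer.Theorems.ByReductionTypeAtTwoAdditivePotMultKatoHalf
import HarnessLib

/-!
# Crux `AdditiveRankZeroAtTwo` (K4 item 19098): the crux BY NAME from its one-sided residual, v5 — the over-`K`
# child C4″ `AdditivePotMultOverKAtTwo` (item 22618) NEEDED ONLY on the potentially multiplicative curves with a
# split multiplicative twist by `−1` or `−2` at `2` or with reducible `E[2]` (seat `bsd-2adic-addL2x` GEN 13)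

Cell `bsd-2adic`, rung K4, crux stmt-BirchSwinnertonDyer-19098, split v2.2 (children C1″ 22615, C2″ 22616, C3″ 22617,
C4″ 22618, C5‴ 22619, glue 22620). `--supports 19098 --as helper`. HONEST FRAMING (D-0036/D-0054): an assembly-shaped
CONDITIONAL theorem; every research-grade input is displayed; closes nothing at the `∀`-level; nothing booked; BSD is
not proved by any of this. NO restate of the executed split is asked (record for the planner).

WHAT THIS FILE DOES. GEN 11's glue `additiveRankZeroAtTwo_of_residual_v4` (p627985; file
`…AdditivePotGoodKatoHalf.lean`) sends EVERY potentially multiplicative curve (`ord₂ j < 0`) through lane A's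
over-`K` object (binder `hQKm` = child C4″ verbatim). GEN 13's consumer `…AdditivePotMultKatoHalf.lean` of the
reading `Kato2004.rankZero_padicValNat_sha_add_padicValNat_tamagawa_le_at_two_of_noSplitTwistNegOneNegTwo_of_irreducible_of_fineSelmerDual_fg`
(Kato at `2` for ADDITIVE reduction under (NST′) «no split multiplicative twist by `−1` or `−2` at `2`» (APPEND reading)) puts the
potentially multiplicative (NST′) `E[2]`-IRREDUCIBLE curves into the same one-sided shape as the potentially good
block. v5 = v4 with:
* `hSharp` REPLACED by `hNST2` (the new reading implies the sharp potentially-good reading,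
  `katoAtTwoSharp_of_katoAtTwoNST'`), so the potentially-good branch (children C1″ `hAna`, C2″ `hRest`,
  C3″ `hLow` VERBATIM) is v4's §3 unchanged;
* the potentially-multiplicative branch SPLIT: on {(NST′) ∧ `E[2]` irreducible} — `addPotMultNST_bsdp_two_of_conjA_of_lower`
  with the two NEW displayed inputs (I1M) `hAnaM` = statement (A) at `(W,2)` on those curves whose `2`-division
  field is NOT abelian (the C1″-shaped object on this sub-block) and (I3M) `hLowM` = the lower half over `ℚ` on
  this sub-block (the C3″-shaped object); on the complement — v4's §4 AT THE CURVE
  (`addPotMult_bsdp_two_of_mult_of_overKC_at`) with (I4″′) `hQKm'` = child C4″ RESTRICTED by the extra hypothesis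
  `¬ ((NST′) ∧ E[2] irreducible)` (a verbatim weakening of C4″: C4″ ⟹ `hQKm'`).
Inputs: PRINT {`hGZK`, `hmod`, `hmodN`, `hMilneC`, `hHL`, `hLim2`, `hFW`, `hCassels`, `hCT`} + READINGS {`hNST2`
(D-audit owed), `hin` (D-audit PASS hMH2@2)} + sibling {`hMult`} + research `∀`-objects {C1″ `hAna`, C2″ `hRest`,
C3″ `hLow`, (I1M) `hAnaM`, (I3M) `hLowM`, (I4″′) `hQKm'`}. Census (lane A phi_census, re-read
`pub/bsd-2adic/addL2x/gen13/POTMULT-NST-CENSUS-19098-addL2x-GEN13.tsv`): of the 463 potentially multiplicative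
rank-`0` classes, 194 are (NST′) ∧ irreducible (moved off C4″), 269 stay on C4″ (61 (NST′) reducible, 208 with a split
twist by `−1` or `−2`).

* §1 `addPotMult_bsdp_two_of_mult_of_overKC_at` — v4's §4 at ONE curve (the over-`K` input only at `W`).
* §2 `additiveRankZeroAtTwo_of_residual_v5` — the crux by name (type = the route decl verbatim).

References: [Kato2004Asterisque] Thm. 12.5 (3), (12.5.1), 13.13, 14.14; [SilvermanATAEC1994] V.5.3, Ex. 5.11;
[CoatesSujatha2005] statement (A); [Lim2017FineSelmer] Thm. 3.5; [Milne1972ArithmeticAV] Thm. 1; [HoffsteinLuo1997];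
[Cassels1965ArithmeticVIII]; [SilvermanAEC2009] X.4.14; [Miller2011LMS] Def. 1.1.
-/

set_option autoImplicit false
set_option linter.dupNamespace false

noncomputable section

open scoped Classical

namespace Summit.BirchSwinnertonDyer.BirchSwinnertonDyer.Theorems.AddKatoTwo

open WeierstrassCurve Literature.NumberTheory.EllipticCurves
  Literature.NumberTheory.EllipticCurves.ModularForms
  Literature.NumberTheory.EllipticCurves.Kato2004
  Literature.NumberTheory.EllipticCurves.Rank1Residual
  Literature.NumberTheory.EllipticCurves.Rank1Residual.Typed
  Literature.NumberTheory.IwasawaTheory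
  Summit.BirchSwinnertonDyer.Rank1Residual Summit.BirchSwinnertonDyer.Rank1Residual.AdditivePotMult
  Summit.BirchSwinnertonDyer.Rank1Residual.X5.AddTwoL2
  Summit.BirchSwinnertonDyer.BirchSwinnertonDyer.Theses.ByReductionTypeAtTwo

/-! ## §1 v4's potentially-multiplicative door AT ONE CURVE -/

/-- **BSD₂ at ONE additive potentially-multiplicative curve at `2` from the SINGLE sibling crux
`MultiplicativeRankZeroAtTwo` and lane A's over-`K` input AT THAT CURVE.** Word for word the proof of v4's
`addPotMult_bsdp_two_of_mult_of_overKC` (`quadSemistabilisable_of_potMult`, Hoffstein–Luo through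
`existsSemistabilisingNonvanishingTwist_of_hoffsteinLuo`, a minimal model of the semistable twist — multiplicative by
`mult_of_semistableTwist_of_padicValRat_j_neg` —, `hMult`, and Milne's any-model descent `bsdp_of_pPartOverC_baseChange`),
with the over-`K` hypothesis quantified over `K` only, at the given `W` — so that a RESTRICTED block binder can be fed.
Conditional; closes nothing. [cite: Milne1972ArithmeticAV, §1 Thm. 1 (through DokchitserDokchitserAnnals2010 §2.1)]
[cite: HoffsteinLuo1997, Theorem] [cite: SilvermanAEC2009, Prop. VII.5.5] -/
theorem addPotMult_bsdp_two_of_mult_of_overKC_at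
    (hGZK : rank_eq_analyticRank_of_analyticRank_le_one) (hmod : hasEntireLFunction_rat)
    (hMilneC : Milne1972.bsdQuotient_baseChange_quadratic_anyModel)
    (hHL : HoffsteinLuo1997_exists_twist_L_one_ne_zero)
    (hMult : MultiplicativeRankZeroAtTwo)
    (W : WeierstrassCurve ℚ) [W.IsElliptic] [W.IsGloballyMinimal] (hcm : ¬ W.HasCM) (hr : W.analyticRank = 0)
    (hadd : Addv W 2) (hj : padicValRat 2 W.j < 0)
    (hQK : ∀ (K : Type) [Field K] [NumberField K], Module.finrank ℚ K = 2 →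
        SemistableTwistAtTwo W K → (W.quadraticTwist (NumberField.discr K : ℚ)).entireLFunction 1 ≠ 0 →
          MissingPPartOverCAt (W.baseChange K) 2) :
    BSDp W 2 := by
  haveI : Fact (Nat.Prime 2) := ⟨Nat.prime_two⟩
  have hq : QuadSemistabilisable W := quadSemistabilisable_of_potMult W ⟨hadd, hj⟩
  obtain ⟨K, _, _, h2, hst, hL⟩ := Theorems.existsSemistabilisingNonvanishingTwist_of_hoffsteinLuo hHL W hq
  obtain ⟨Wd, _, _, hWd, hcmd, hrd, hred⟩ := Theorems.exists_minimalTwist_semistable_rankZero W hcm K hst hL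
  have hd : (NumberField.discr K : ℚ) ≠ 0 := by exact_mod_cast NumberField.discr_ne_zero K
  have hm : Mult Wd 2 := mult_of_semistableTwist_of_padicValRat_j_neg W hj hd Wd hWd hred
  exact bsdp_of_pPartOverC_baseChange W 2 K Wd hGZK hmod hMilneC (by omega) h2 hWd (by omega)
    (hQK K h2 hst hL) (hMult Wd hcmd hrd hm)

/-! ## §2 The crux BY NAME, ONE-SIDED (glue v5) -/

/-- **The crux `AdditiveRankZeroAtTwo` (item stmt-BirchSwinnertonDyer-19098; type = the route decl verbatim) from its
ONE-SIDED residual, v5.** Inputs: PRINT {`hGZK`, `hmod`, `hmodN`, `hMilneC`, `hHL`, `hLim2`, `hFW`, `hCassels`,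
`hCT`} + READINGS {`hNST2` = Kato at `2` for additive reduction under (NST′), `hin` = Kato's member reading} + the
sibling crux `hMult` (`MultiplicativeRankZeroAtTwo`, item 19096) + the research-grade `∀`-objects: C1″ `hAna`
(statement (A) on the potentially good non-abelian-`ℚ(E[2])` curves), C2″ `hRest` (the reducible potentially-good
rest), C3″ `hLow` (the lower half over `ℚ`, potentially good) — all three VERBATIM the children of the split —,
(I1M) `hAnaM` (statement (A) at `(W,2)` on the potentially MULTIPLICATIVE curves satisfying (NST′) with `E[2]`
irreducible and `ℚ(E[2])` non-abelian), (I3M) `hLowM` (the lower half over `ℚ` on the potentially multiplicative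
(NST′) irreducible curves), and (I4″′) `hQKm'` = child C4″ `AdditivePotMultOverKAtTwo` RESTRICTED to the curves NOT in
{(NST′) ∧ irreducible}. Split by the sign of `ord₂ j`; the negative side split again by (NST′) ∧ irreducible. Versus v4
(GEN 11): `hSharp ↦ hNST2` (implies it), C4″ shrinks to its complement sub-block (census: 269 of 463 classes), two
displayed inputs of the C1″/C3″ shape appear on the other 194. Conditional (audit `proof.conditional`); the item is
NOT closed by this theorem; no restate of the split is asked.
[cite: Kato2004Asterisque, Thm. 12.5 (3) and (12.5.1) (p. 222), 13.13 (p. 233), Thm. 12.6 (p. 222), §14.14 (p. 243), Prop. 14.16 (2) (p. 244)]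
[cite: SilvermanATAEC1994, Thm. V.5.3 and Exercise 5.11] [cite: CoatesSujatha2005, statement (A)]
[cite: Lim2017FineSelmer, §3 Thm. 3.5] [cite: Milne1972ArithmeticAV, Thm. 1] [cite: HoffsteinLuo1997, Theorem]
[cite: Cassels1965ArithmeticVIII] [cite: SilvermanAEC2009, Thm. X.4.14] [cite: Miller2011LMS, Def. 1.1] -/
theorem additiveRankZeroAtTwo_of_residual_v5
    (hGZK : rank_eq_analyticRank_of_analyticRank_le_one) (hmod : hasEntireLFunction_rat) (hmodN : exists_isNewformOf)
    (hMilneC : Milne1972.bsdQuotient_baseChange_quadratic_anyModel)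
    (hHL : HoffsteinLuo1997_exists_twist_L_one_ne_zero)
    (hLim2 : Lim2017.thm35_at_two_fineSelmerDual_moduleFinite_of_classicalMuVanishes_of_le_divisionField_four)
    (hFW : ferreroWashington1979_classicalMuVanishes)
    (hCassels : bsdRHS_eq_of_isIsogenous) (hCT : exists_casselsTate_pairing (K := ℚ))
    (hNST2 : Kato2004.rankZero_padicValNat_sha_add_padicValNat_tamagawa_le_at_two_of_noSplitTwistNegOneNegTwo_of_irreducible_of_fineSelmerDual_fg)
    (hin : Kato2004.exists_memberHullInputs_two)
    (hMult : MultiplicativeRankZeroAtTwo)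
    (hAna : ∀ (W : WeierstrassCurve ℚ) [W.IsElliptic] [W.IsGloballyMinimal], ¬ W.HasCM → W.analyticRank = 0 →
      Addv W 2 → 0 ≤ padicValRat 2 W.j → ¬ IsAbelianGalois ℚ (W.divisionField 2) →
      ∀ (κ : ZpExtension ℚ 2), κ.IsCyclotomic →
        ∃ (γ : Field.absoluteGaloisGroup ℚ) (D : W.FineSelmerDualData κ γ),
          Module.Finite ℤ_[2] (RestrictScalars ℤ_[2] (IwasawaAlgebra 2) D.X))
    (hRest : ∀ (W : WeierstrassCurve ℚ) [W.IsElliptic] [W.IsGloballyMinimal], ¬ W.HasCM → W.analyticRank = 0 →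
      Addv W 2 → 0 ≤ padicValRat 2 W.j → ¬ W.HasIrreducibleModPGaloisRep 2 →
      ¬ ((∀ (W' : WeierstrassCurve ℚ) [W'.IsElliptic], IsIsogenous W W' → ¬ 2 ^ 2 ∣ W'.torsionOrder) ∧
          (∀ q : ℚ, shaAn W = (q : ℂ) → Even (padicValRat 2 q))) →
      MissingUpperBoundAt W 2)
    (hLow : ∀ (W : WeierstrassCurve ℚ) [W.IsElliptic] [W.IsGloballyMinimal], ¬ W.HasCM → W.analyticRank = 0 →
      Addv W 2 → 0 ≤ padicValRat 2 W.j → MissingLowerBoundAt W 2)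
    (hAnaM : ∀ (W : WeierstrassCurve ℚ) [W.IsElliptic] [W.IsGloballyMinimal], ¬ W.HasCM → W.analyticRank = 0 →
      Addv W 2 → padicValRat 2 W.j < 0 →
      (∀ d : ℚ, d = -1 ∨ d = -2 → ¬ (W.quadraticTwist d).HasSplitMultiplicativeReductionAtPrime 2) →
      W.HasIrreducibleModPGaloisRep 2 → ¬ IsAbelianGalois ℚ (W.divisionField 2) →
      ∀ (κ : ZpExtension ℚ 2), κ.IsCyclotomic →
        ∃ (γ : Field.absoluteGaloisGroup ℚ) (D : W.FineSelmerDualData κ γ),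
          Module.Finite ℤ_[2] (RestrictScalars ℤ_[2] (IwasawaAlgebra 2) D.X))
    (hLowM : ∀ (W : WeierstrassCurve ℚ) [W.IsElliptic] [W.IsGloballyMinimal], ¬ W.HasCM → W.analyticRank = 0 →
      Addv W 2 → padicValRat 2 W.j < 0 →
      (∀ d : ℚ, d = -1 ∨ d = -2 → ¬ (W.quadraticTwist d).HasSplitMultiplicativeReductionAtPrime 2) →
      W.HasIrreducibleModPGaloisRep 2 → MissingLowerBoundAt W 2)
    (hQKm' : ∀ (W : WeierstrassCurve ℚ) [W.IsElliptic] [W.IsGloballyMinimal], ¬ W.HasCM → W.analyticRank = 0 →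
      Addv W 2 → padicValRat 2 W.j < 0 →
      ¬ ((∀ d : ℚ, d = -1 ∨ d = -2 → ¬ (W.quadraticTwist d).HasSplitMultiplicativeReductionAtPrime 2) ∧
          W.HasIrreducibleModPGaloisRep 2) →
      ∀ (K : Type) [Field K] [NumberField K], Module.finrank ℚ K = 2 →
        SemistableTwistAtTwo W K → (W.quadraticTwist (NumberField.discr K : ℚ)).entireLFunction 1 ≠ 0 →
          MissingPPartOverCAt (W.baseChange K) 2) :
    Summit.BirchSwinnertonDyer.BirchSwinnertonDyer.Theses.ByReductionTypeAtTwo.AdditiveRankZeroAtTwo := by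
  unfold Summit.BirchSwinnertonDyer.BirchSwinnertonDyer.Theses.ByReductionTypeAtTwo.AdditiveRankZeroAtTwo
  intro W _ _ hcm hr hadd
  haveI : Fact (Nat.Prime 2) := ⟨Nat.prime_two⟩
  by_cases hj : 0 ≤ padicValRat 2 W.j
  · exact addPotGood_bsdp_two_of_kato_of_lower hGZK hmod hmodN hLim2 hFW hCassels hCT
      (katoAtTwoSharp_of_katoAtTwoNST' hNST2) hin hAna hRest hLow W hcm hr hadd hj
  · have hj' : padicValRat 2 W.j < 0 := lt_of_not_ge hj
    by_cases hsub : (∀ d : ℚ, d = -1 ∨ d = -2 →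
        ¬ (W.quadraticTwist d).HasSplitMultiplicativeReductionAtPrime 2) ∧ W.HasIrreducibleModPGaloisRep 2
    · exact addPotMultNST_bsdp_two_of_conjA_of_lower hNST2 hGZK hmod hLim2 hFW hAnaM hLowM W hcm hr hadd hj'
        hsub.1 hsub.2
    · exact addPotMult_bsdp_two_of_mult_of_overKC_at hGZK hmod hMilneC hHL hMult W hcm hr hadd hj'
        (hQKm' W hcm hr hadd hj' hsub)

/-- **C4″ ⟹ its restriction (I4″′)**: the executed child `AdditivePotMultOverKAtTwo` (item 22618) implies the
restricted binder `hQKm'` of v5 — the extra hypothesis is simply dropped. So v5 is fed by the five children of split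
v2.2 plus (I1M), (I3M); bookkeeping. [cite: Miller2011LMS, Def. 1.1] -/
theorem hQKm'_of_additivePotMultOverKAtTwo (h : AdditivePotMultOverKAtTwo) :
    ∀ (W : WeierstrassCurve ℚ) [W.IsElliptic] [W.IsGloballyMinimal], ¬ W.HasCM → W.analyticRank = 0 →
      Addv W 2 → padicValRat 2 W.j < 0 →
      ¬ ((∀ d : ℚ, d = -1 ∨ d = -2 → ¬ (W.quadraticTwist d).HasSplitMultiplicativeReductionAtPrime 2) ∧
          W.HasIrreducibleModPGaloisRep 2) →
      ∀ (K : Type) [Field K] [NumberField K], Module.finrank ℚ K = 2 →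
        SemistableTwistAtTwo W K → (W.quadraticTwist (NumberField.discr K : ℚ)).entireLFunction 1 ≠ 0 →
          MissingPPartOverCAt (W.baseChange K) 2 := by
  intro W _ _ hcm hr hadd hj _ K _ _ h2 hst hL
  exact h W hcm hr hadd hj K h2 hst hL

end Summit.BirchSwinnertonDyer.BirchSwinnertonDyer.Theorems.AddKatoTwo

end
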